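import Literature.Probability.Percolation.ArmSeparationNearCriticalFour
import Literature.Probability.Percolation.KestenScalingThetaFromTwoAltDisplays
import Literature.Probability.Percolation.AltFourArmLowerBound
import HarnessLib

/-!
# One-arm stability below `L(p)` and `θ(p) ≍ π₁(L(p))`: discharges from alternating separation

Topic `Literature/Probability/Percolation`; family `crit-perc` / near-critical percolation on `𝕋`.
PROOFS ONLY (no definition, no named fact). With the near-critical arm-separation theorem for four
alternating arms now a theorem of the tree (`altSeparation_display`, `ArmSeparationNearCriticalFour`:
Nolin 2008, Thm. 11 for `σ = BWBW` [arXiv 0711.4948: Thm. 10], §4.2–4.4) and the a priori lower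
bound of the alternating four-arm probability (`altFourArm_lowerBound`, `AltFourArmLowerBound`),
the tree's displayed reductions close four named facts outright:

* `Werner2009_oneArm_logDeriv_holds` (`WernerPivotalEstimates`; Werner 2009, Lecture 6, §5, the
  differential inequality (C) for the one-arm event) — `Werner2009_oneArm_logDeriv_of_altSeparation'`;
* `Werner2009_oneArm_nearCritical_holds` (`WernerCorrelationLength`; Werner 2009, Lecture 6, §5:
  `P_p(0 ↔ ∂Λ_n) ≍ P_{1/2}(0 ↔ ∂Λ_n)` for `n ≤ L(p)`) — `Werner2009_oneArm_nearCritical_of_altSeparation'`;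
* `Nolin2008_thm27_oneArm_holds` (`NearCriticalScaling`; Nolin 2008, Thm. 27 [arXiv Thm. 26] for
  `j = 1`) — `Nolin2008_thm27_oneArm_of_altSeparation`;
* `Nolin2008_theta_asymp_holds` (`KestenScaling`; Nolin 2008, §7.4, (7.25) [arXiv: the display
  following Cor. 39]: `θ(p) ≍ P_{1/2}(0 ↔ ∂Λ_{L_ε(p)})`) —
  `Nolin2008_theta_asymp_of_altSeparation_of_altLB`.

This file is a leaf (the host files of the four facts lie below the arm-separation files in the
import order). Everything here is proved; no named facts are introduced.

## References

* P. Nolin, Near-critical percolation in two dimensions, *Electron. J. Probab.* 13 (2008), §4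
  Thm. 11, §6.2 Thm. 27, §7.4 Cor. 41 and (7.25) (arXiv 0711.4948: Thm. 10, Thm. 26, Cor. 39)
  [Nolin2008].
* W. Werner, Lectures on two-dimensional critical percolation, IAS/Park City Math. Ser. 16 (2009),
  Lecture 6, Prop. 6.1, §3, §5 [WernerPCMI2009].
* H. Kesten, Scaling relations for 2D-percolation, *Comm. Math. Phys.* 109 (1987), Lemma 6, Thm. 2
  [Kesten1987].
-/

noncomputable section

namespace Literature.Probability.Percolation

/-- **Werner 2009, Lecture 6, §5, (C) holds**: the differential inequality for the one-arm
probability below `L(p)`, from alternating four-arm separation (`altSeparation_display`) through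
`Werner2009_oneArm_logDeriv_of_altSeparation'`. [cite: WernerPCMI2009, Lecture 6, §5 with §3 and Prop. 6.1] [cite: Nolin2008, Thm. 11 (arXiv 0711.4948: Thm. 10)] -/
theorem Werner2009_oneArm_logDeriv_holds : Werner2009_oneArm_logDeriv :=
  Werner2009_oneArm_logDeriv_of_altSeparation' altSeparation_display

/-- **Werner 2009, Lecture 6, §5, one-arm stability below `L(p)` holds**:
`P_p(0 ↔ ∂Λ_n) ≍ P_{1/2}(0 ↔ ∂Λ_n)` uniformly for `n ≤ L(p)`, from alternating four-arm separation
(`altSeparation_display`) through `Werner2009_oneArm_nearCritical_of_altSeparation'`. [cite: WernerPCMI2009, Lecture 6, §5 with §3–§4] [cite: Nolin2008, §6.2 Thm. 27 with Thm. 11 (arXiv 0711.4948: Thm. 26, Thm. 10)] -/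
theorem Werner2009_oneArm_nearCritical_holds : Werner2009_oneArm_nearCritical :=
  Werner2009_oneArm_nearCritical_of_altSeparation' altSeparation_display

/-- **Nolin 2008, Thm. 27 for one arm holds**: `P_p(0 ↔ ∂Λ_N) ≍ P_{1/2}(0 ↔ ∂Λ_N)` uniformly for
`N ≤ L_ε(p)`, from alternating four-arm separation (`altSeparation_display`) through
`Nolin2008_thm27_oneArm_of_altSeparation`. [cite: Nolin2008, §6.2 Thm. 27 (arXiv 0711.4948: Thm. 26), with Thm. 11 (Thm. 10)] -/
theorem Nolin2008_thm27_oneArm_holds : Nolin2008_thm27_oneArm :=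
  Nolin2008_thm27_oneArm_of_altSeparation altSeparation_display

/-- **Nolin 2008, §7.4, (7.25) holds**: `θ(p) ≍ P_{1/2}(0 ↔ ∂Λ_{L_ε(p)})` for `p` in a right
neighbourhood of `1/2`, from alternating four-arm separation (`altSeparation_display`) and the
a priori lower bound (`altFourArm_lowerBound`) through
`Nolin2008_theta_asymp_of_altSeparation_of_altLB`. [cite: Nolin2008, §7.4, (7.25) with Cor. 41 and Thm. 27 (arXiv 0711.4948: the display following Cor. 39)] [cite: Kesten1987, Thm. 2] -/
theorem Nolin2008_theta_asymp_holds : Nolin2008_theta_asymp :=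
  Nolin2008_theta_asymp_of_altSeparation_of_altLB altSeparation_display altFourArm_lowerBound

end Literature.Probability.Percolation

end
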